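/-
Origin: expansion seat `prover-pub-hodgecm-mc-sinst-1-g10-0`, handover #1256 2026-08-21T01:23Z md5 69f7c135de24 (335 l.; NEW additive leaf; §1 ns HodgeCM.Model.SplitLine: def ΩTwistByEquiv p ιV ĉ hĉ hχ : (p.twistBy ĉ hĉ).Ω ιV χ' ≃ₗ[adelicAlgebra V] (SeesawScalar.twist ((twistCharV … ĉ).comp ιV) ((weilCoinv … χ p.hs).comp ιV)).asModule (axioms-1 #8 Ω_twistBy + Ω_twistBy_eq_twist packaged by #1254 liftEquiv); §2 ns HodgeCM.Model.ThetaAdelicSide: coinvEquivZero_twist_of_eq, def dictEquivZeroOfBigChar (ĉ) (hĉ : IsRatTrivial ĉ) (hĉV : (twistCharV … ĉ).comp finFrameCongr = cVZero) (χ'') (hχ'' : ∀ u, χ'' u = twistCharW … ĉ u * ψ u) : ((splitLineZero V c hGR₀).twistBy ĉ hĉ).Ω (finFrameCongr …) χ'' ≃ₗ[adelicAlgebra V] (D₀.coinvRep χ).asModule, iSup_range_coinvRep_zero_eq_dict; §3 def adelicCharZero := (eta₀ η).comp inl * (cmLineChar₀ … hGR hGR₀ hGR₁).comp inl (+ _apply),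 lineVec_dW_zero_ne, def bigCharZero := LinePair.bigCharOfV … adelicCharZero : (splitLineZero …).BigChar, twistCharV_bigCharZero_comp (hĉV DISCHARGED); §4 cmLineChar₀_inl_eq_one_of_rat (charV₃₄_eq_one_of_rational at ratIsometry_one_lineVec), adelicCharZero_eq_one_of_rat (hη via cmEta₀_eq_one_of_rat), bigCharZero_isRatTrivial : (splitLineZero …).IsRatTrivial (bigCharZero …), def splitLineZeroTwisted := (splitLineZero …).twistBy (bigCharZero …) (bigCharZero_isRatTrivial …), def dictEquivZero, iSup_range_coinvRep_zero_eq_dictTwisted, def charZeroDict χ := twistCharW … (bigCharZero …) * psiZero … χ, def dictEquivZeroCanonical χ : (splitLineZeroTwisted V c hGR hGR₀ hGR₁ η hη).Ω (finFrameCongr …) (charZeroDict … χ) ≃ₗ[adelicAlgebra V] ((thetaDistDatumZeroOf … Φarch harm hdef).coinvRep χ).asModule, dictEquivZeroCanonical_surjective; NAMES for audit: HodgeCM.Model.ThetaAdelicSide.twistCharV_bigCharZero_comp · HodgeCM.Model.ThetaAdelicSide.bigCharZero_isRatTrivial · HodgeCM.Model.ThetaAdelicSide.dictEquivZeroCanonical_surjective)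 (`HOME/mc/pub-hodgecm-mc-sinst-1-g10/stage69/HodgeCM/Model/AdelicThetaDistributionBridgeTwist.lean`, md5 69f7c135de24, 335 lines);
landed by the gen-29 packager (p-g29) in gate run 69 as `HodgeCM/Model/AdelicThetaDistributionBridgeTwist.lean` (verbatim).
-/
/-
Copyright (c) 2026 the pub-hodgecm formalisation cell (harness21).  New file, not vendored.
Origin: session prover-pub-hodgecm-mc-sinst-1-g10-0 (unit pub-hodgecm-mc-sinst-1-g10, S-INSTANCE CONSTRUCTOR gen 10; DATUM SEAM 2 part (γ),
slot assembly: the honest slot-0 module `Ω₀(χ)` IS, as a `ℂ[U(V)(𝔸_f)]`-module, the dictionary carrier of the TWISTED RECORD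
`splitLineZero.twistBy ĉ hĉ` for every automorphic big character `ĉ` with `V`-part `cVZero`, and such a `ĉ` exists), 2026-08-21.
Intended final place: `HodgeCM/Model/AdelicThetaDistributionBridgeTwist.lean` (NEW additive model-layer leaf; imports sinst-1
#1254 `AdelicThetaDistributionBridge`, #1255 `AdelicLinePair`, axioms-1 #8 `LiuDictionaryInstanceTwistOmega`; nothing imports it).
-/
import Summits.HodgeConjecture.HodgeCM.Model.AdelicThetaDistributionBridge_2
import Summits.HodgeConjecture.HodgeCM.Model.AdelicLinePair
import Summits.HodgeConjecture.HodgeCM.Model.LiuDictionaryInstanceTwistOmega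

set_option autoImplicit false

/-!
# Slot 0 of the honest side lands in the Weil-coinvariant dictionary through a twisted record

#1254 `ΩEquivZero`: `Ω₀(χ) ≅ (Ω(splitLineZero, ψ) ∘ finFrameCongr) ⊗ cVZero` as `ℂ[U(V)(𝔸_f)]`-modules.  axioms-1 #8 `Ω_twistBy` /
`Ω_twistBy_eq_twist`: `Ω(p.twistBy ĉ hĉ, twistCharW ĉ · ψ) ≅ Ω(p, ψ) ⊗ (twistCharV ĉ ∘ ιV)` (ℂ-linear, with the intertwining law).
Hence (KERNEL only):
* § 1 **`SplitLine.ΩTwistByEquiv`** — #8's comparison packaged `adelicAlgebra V`-linearly (`EquivariantLift.liftEquiv`);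
* § 2 **`dictEquivZeroOfBigChar`**: for every big character `ĉ` of `splitLineZero` with `IsRatTrivial ĉ` and
  `(twistCharV ĉ).comp finFrameCongr = cVZero`, and `χ″ = twistCharW ĉ · ψ`,
  `((splitLineZero V c hGR₀).twistBy ĉ hĉ).Ω finFrameCongr χ″ ≃ₗ[adelicAlgebra V] Ω₀(χ)` (+ blocks equal);
* § 3 THE CHARACTER: **`bigCharZero := LinePair.bigCharOfV … adelicCharZero`** with `adelicCharZero := η(·, 1) · cmLineChar₀(·, 1)` on
  `U(diag frameD V)(𝔸)`; **`twistCharV_bigCharZero_comp : (twistCharV bigCharZero).comp finFrameCongr = cVZero`**.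
* § 4 **`bigCharZero_isRatTrivial`** (the W pin's `hη` for `η(γ, 1)` + [Weil1964, Thm 6] for `λ_V′` through the tree's
  `charV₃₄_eq_one_of_rational`, transferred by #1255 `bigCharOfV_rationalPairToAdelic'`), the twisted record
  **`splitLineZeroTwisted := splitLineZero.twistBy ĉ₀ _`**, and **`dictEquivZero` ∕ `dictEquivZeroCanonical χ :
  Ω(splitLineZeroTwisted, charZeroDict χ) ≃ₗ[adelicAlgebra V] Ω₀(χ)`** — slot 0 of the honest side IS a dictionary carrier, no
  hypothesis on the record left (+ `iSup_range_coinvRep_zero_eq_dictTwisted`, `dictEquivZeroCanonical_surjective`).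
0 records, 0 `def … : Prop`, nothing cited as a hypothesis; `#print axioms` ⊆ {propext, Classical.choice, Quot.sound}.
-/

noncomputable section

open MulAction IsDedekindDomain NumberField.mixedEmbedding
open NumberField hiding relNormOneIdeles relNormOneRat probHaarRelNormOneQuot
open scoped Matrix TensorProduct Classical SchwartzMap
open Literature.NumberTheory.Automorphic Literature.NumberTheory.Weil1964
open Literature.NumberTheory.GelbartRogawski1991 Literature.NumberTheory.GelbartRogawski1991.UnitaryDualPair
open Literature.RepresentationTheory (SeesawScalar.twist SeesawScalar.twist_apply)
open Literature.Geometry.ComplexHyperbolic.BallModel (U21 x₀)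
open Literature.AlgebraicGeometry.ShimuraVarieties
open HodgeCM.Adelic HodgeCM.PerL34 HodgeCM.Model.ArchSideTerm HodgeCM.Model.ThetaDistFin

namespace HodgeCM.Model

/-! ## § 1. #8's twist comparison, `adelicAlgebra V`-linearly -/

namespace SplitLine

variable {L : CMField} {ι₁ : (L : Type) →+* ℂ} {V : HermSpace3 L ι₁}
variable {JV : Matrix (Fin 3) (Fin 3) (L : Type)} {TV : Matrix (Fin 3) (Fin 3) ↥(maximalRealSubfield (L : Type))}
  {δ : (L : Type)} {hcδ : IsCMField.complexConj (L : Type) δ = -δ} {hδ : δ ≠ 0} {d : ↥(maximalRealSubfield (L : Type))}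
  {hd : δ * δ = algebraMap _ (L : Type) d} {hV : TV.IsSymm} {hVd : IsUnit TV.det}
  {hJV : JV = TV.map (algebraMap _ (L : Type))}
variable (p : SplitLine JV TV hcδ hδ hd hV hVd hJV)
  (ιV : ↥V.adelicFin →*
    ↥(UnitaryGroup.finAdelic (↥(maximalRealSubfield (L : Type))) (L : Type) (IsCMField.complexConj (L : Type)) 3 JV))

/-- **`Ω(p ⊗ ĉ, ĉ_W · χ) ≅ Ω(p, χ) ⊗ (ĉ_V ∘ ιV)` as `ℂ[U(V)(𝔸_f)]`-MODULES** — axioms-1's carrier comparison `Ω_twistBy` with its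
intertwining law `Ω_twistBy_eq_twist`, packaged by `EquivariantLift.liftEquiv`. [cite: GelbartRogawski1991, §3.1 Remark p. 457 L4–13] -/
def ΩTwistByEquiv (ĉ : p.BigChar) (hĉ : p.IsRatTrivial ĉ) {χ χ' : p.CharW}
    (hχ : ∀ u, χ' u =
      HodgeCM.WeilCoinv.twistCharW (↥(maximalRealSubfield (L : Type))) (L : Type) (IsCMField.complexConj (L : Type)) 3 1 JV p.JW
          ĉ u * χ u) :
    (p.twistBy ĉ hĉ).Ω ιV χ' ≃ₗ[adelicAlgebra V]
      (SeesawScalar.twist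
          ((HodgeCM.WeilCoinv.twistCharV (↥(maximalRealSubfield (L : Type))) (L : Type) (IsCMField.complexConj (L : Type)) 3 1 JV
                p.JW ĉ).comp ιV)
          ((HodgeCM.WeilCoinv.weilCoinv (↥(maximalRealSubfield (L : Type))) (L : Type) (IsCMField.complexConj (L : Type)) 3 1
                p.e JV p.JW hcδ hδ hd hV p.hW hVd p.hWd hJV p.hJW χ p.hs).comp ιV)).asModule :=
  EquivariantLift.liftEquiv _ _ (p.Ω_twistBy ιV ĉ hĉ hχ) (p.Ω_twistBy_eq_twist ιV ĉ hĉ hχ)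

end SplitLine

/-! ## § 2. Slot 0 through a twisted record -/

namespace ThetaAdelicSide

variable {L : CMField} {ι₁ : L →+* ℂ} (V : HermSpace3 L ι₁) (c : SeesawCtx L)
  (hGR : (cmSplittingDatum (L : Type) finProdFinEquiv (frameD V) (frameD_real V) (frameD_ne V) (dW c.D) (dW_real c.D)
    (dW_ne c.D)).CompatibleSplitting)
  (hGR₀ : (cmSplittingDatum (L : Type) (e₁) (frameD V) (frameD_real V) (frameD_ne V) (lineVec (L : Type) (dW c.D 0))
    (fun _ => dW_real c.D 0) (fun _ => dW_ne c.D 0)).CompatibleSplitting)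
  (hGR₁ : (cmSplittingDatum (L : Type) (e₁) (frameD V) (frameD_real V) (frameD_ne V) (lineVec (L : Type) (dW c.D 1))
    (fun _ => dW_real c.D 1) (fun _ => dW_ne c.D 1)).CompatibleSplitting)
  (hGR₂ : (cmSplittingDatum (L : Type) (e₁) (frameD V) (frameD_real V) (frameD_ne V) (lineVec (L : Type) (dW' c.D 0))
    (fun _ => dW'_real c.D 0) (fun _ => dW'_ne c.D 0)).CompatibleSplitting)
  (hGR₃ : (cmSplittingDatum (L : Type) (e₁) (frameD V) (frameD_real V) (frameD_ne V) (lineVec (L : Type) (dW' c.D 1))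
    (fun _ => dW'_real c.D 1) (fun _ => dW'_ne c.D 1)).CompatibleSplitting)
  (η : CMAdelic (L : Type) (frameD V) × CMAdelic (L : Type) (dW c.D) →* ℂˣ)
  (hη : ∀ γU ∈ CMRat (L : Type) (frameD V), ∀ γ ∈ CMRat (L : Type) (dW c.D), η (γU, γ) = 1)
  (hηc : Continuous fun p => ((η p : ℂˣ) : ℂ))
  (h₁W : (∀ j, 0 < (ι₁ (dW c.D j)).re) ∨ ∀ j, (ι₁ (dW c.D j)).re < 0)
  (A : ∀ k : Fin 4, ArchLineInput V (lineRepD V c.D hGR hGR₀ hGR₁ hGR₂ hGR₃ η k))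
  (hV : IsAnisotropic L V.Hm)

section Zero

variable (Φarch : Module.Dual ℂ (Fin 2 → ℂ) →ₗ[ℂ] 𝓢((Fin 3 → mixedSpace (↥(maximalRealSubfield L))), ℂ))
  (harm : ∀ (u : ↥(stabilizer U21 x₀)) (ℓ : Module.Dual ℂ (Fin 2 → ℂ)),
    lineOmega_zero V c.D hGR hGR₀ hGR₁ (eta₀ V c.D η) (u : U21) (Φarch ℓ) =
      Φarch ((BallForms.isPullbackCocycle_cotangentCocycle.weightOf x₀).dual u ℓ))
  (hdef : ∀ a : UnitaryGroup.arch (↥(maximalRealSubfield L)) L (IsCMField.complexConj L) 3 V.Hm,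
    UnitaryGroup.archAt (↥(maximalRealSubfield L)) L (IsCMField.complexConj L) 3 V.Hm (UnitaryGroup.cmPlace (L : Type) ι₁)
        (NumberField.complexConj_smul_infinitePlace (L : Type) _) (IsCMField.complexConj_ne_one (L : Type)) a = 1 →
    ∀ (ℓ : Module.Dual ℂ (Fin 2 → ℂ)) (Φf : FinSB (↥(maximalRealSubfield L)) (Fin 3)),
      lineRepOf V c.D hGR hGR₀ hGR₁ hGR₂ hGR₃ (eta₀ V c.D η) (eta₁ V c.D η) (eta₂ V c.D η) (eta₃ V c.D η) 0
          (HodgeCM.Adelic.regimeEquiv L V.Hm hV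
            (UnitaryGroup.archToAdelic (↥(maximalRealSubfield L)) L (IsCMField.complexConj L) 3 V.Hm a), 1)
          (piSchwartzBruhatEquiv (↥(maximalRealSubfield L)) (Fin 3) (Φarch ℓ ⊗ₜ[ℂ] Φf)) =
        piSchwartzBruhatEquiv (↥(maximalRealSubfield L)) (Fin 3) (Φarch ℓ ⊗ₜ[ℂ] Φf))
  (χ : PontryaginDual (↥(relNormOneIdeles (↥(maximalRealSubfield L)) L) ⧸ relNormOneRat (↥(maximalRealSubfield L)) L))
  (ψ : UfZero c.D →* ℂˣ)
  (hψ : ∀ u : UfZero c.D, chiZero c χ u = finCharZero V c.D hGR hGR₀ hGR₁ (eta₀ V c.D η) (1, u) * ψ u)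
  (ĉ : (splitLineZero V c hGR₀).BigChar) (hĉ : (splitLineZero V c hGR₀).IsRatTrivial ĉ)
  (hĉV : (HodgeCM.WeilCoinv.twistCharV (↥(maximalRealSubfield L)) (L : Type) (IsCMField.complexConj L) 3 1
      (Matrix.diagonal (frameD V)) (splitLineZero V c hGR₀).JW ĉ).comp
        (finFrameCongr (L : Type) V.Hm (frameG V) (frameD V) (frame_congr V)) = cVZero V c hGR hGR₀ hGR₁ η)
  (χ'' : (splitLineZero V c hGR₀).CharW)
  (hχ'' : ∀ u, χ'' u =
    HodgeCM.WeilCoinv.twistCharW (↥(maximalRealSubfield L)) (L : Type) (IsCMField.complexConj L) 3 1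
      (Matrix.diagonal (frameD V)) (splitLineZero V c hGR₀).JW ĉ u * ψ u)

/-- the intertwining law of `coinvEquivZero` against the twist by ANY character `cV` that is `finCharZero(·, 1)` pointwise. -/
theorem coinvEquivZero_twist_of_eq (cV : ↥V.adelicFin →* ℂˣ) (hcV : cV = cVZero V c hGR hGR₀ hGR₁ η) (g : ↥V.adelicFin)
    (x : TwistedCoinv.Coinv (HodgeCM.WeilCoinv.finPairRepW _ _ _ _ _ _ _ _ _ _ _ _ _ _ _ _ _ (splitLineZero V c hGR₀).hs) ψ) :
    coinvEquivZero V c hGR hGR₀ hGR₁ hGR₂ hGR₃ η hη hηc h₁W A hV Φarch harm hdef χ ψ hψ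
        (SeesawScalar.twist cV
          ((HodgeCM.WeilCoinv.weilCoinv _ _ _ _ _ _ _ _ _ _ _ _ _ _ _ _ _ ψ (splitLineZero V c hGR₀).hs).comp
            (finFrameCongr (L : Type) V.Hm (frameG V) (frameD V) (frame_congr V))) g x) =
      (thetaDistDatumZeroOf V c hGR hGR₀ hGR₁ hGR₂ hGR₃ η hη hηc h₁W A hV Φarch harm hdef).coinvRep χ g
        (coinvEquivZero V c hGR hGR₀ hGR₁ hGR₂ hGR₃ η hη hηc h₁W A hV Φarch harm hdef χ ψ hψ x) := by
  subst hcV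
  exact coinvEquivZero_twist V c hGR hGR₀ hGR₁ hGR₂ hGR₃ η hη hηc h₁W A hV Φarch harm hdef χ ψ hψ g x

include hψ hĉV in
/-- **SLOT 0 LANDS IN THE DICTIONARY THROUGH THE TWISTED RECORD**: for a rationally trivial big character `ĉ` of `splitLineZero` with
`V`-part `cVZero` along `finFrameCongr`, and `χ″ = twistCharW ĉ · ψ`, axioms-1's carrier `Ω(splitLineZero.twistBy ĉ hĉ, χ″)` IS the
honest slot-0 module `Ω₀(χ)` as a `ℂ[U(V)(𝔸_f)]`-module — the `adelicAlgebra V`-linear surjection of the pinned junction's block socket,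
as an isomorphism. -/
def dictEquivZeroOfBigChar :
    ((splitLineZero V c hGR₀).twistBy ĉ hĉ).Ω (finFrameCongr (L : Type) V.Hm (frameG V) (frameD V) (frame_congr V)) χ''
      ≃ₗ[adelicAlgebra V]
      ((thetaDistDatumZeroOf V c hGR hGR₀ hGR₁ hGR₂ hGR₃ η hη hηc h₁W A hV Φarch harm hdef).coinvRep χ).asModule :=
  ((splitLineZero V c hGR₀).ΩTwistByEquiv (finFrameCongr (L : Type) V.Hm (frameG V) (frameD V) (frame_congr V)) ĉ hĉ hχ'').trans
    (EquivariantLift.liftEquiv _ _ (coinvEquivZero V c hGR hGR₀ hGR₁ hGR₂ hGR₃ η hη hηc h₁W A hV Φarch harm hdef χ ψ hψ)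
      (coinvEquivZero_twist_of_eq V c hGR hGR₀ hGR₁ hGR₂ hGR₃ η hη hηc h₁W A hV Φarch harm hdef χ ψ hψ _ hĉV))

include hψ hĉV hχ'' in
/-- **BLOCKS EQUAL (slot 0, dictionary currency)**. -/
theorem iSup_range_coinvRep_zero_eq_dict {T : Type*} [AddCommMonoid T] [Module ℂ T] [Module (adelicAlgebra V) T]
    [IsScalarTower ℂ (adelicAlgebra V) T] :
    (⨆ f : ((thetaDistDatumZeroOf V c hGR hGR₀ hGR₁ hGR₂ hGR₃ η hη hηc h₁W A hV Φarch harm hdef).coinvRep χ).asModule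
        →ₗ[adelicAlgebra V] T, (LinearMap.range f).restrictScalars ℂ) =
      ⨆ f : ((splitLineZero V c hGR₀).twistBy ĉ hĉ).Ω (finFrameCongr (L : Type) V.Hm (frameG V) (frameD V) (frame_congr V)) χ''
        →ₗ[adelicAlgebra V] T, (LinearMap.range f).restrictScalars ℂ :=
  (EquivariantLift.iSup_range_eq_of_equiv
    (dictEquivZeroOfBigChar V c hGR hGR₀ hGR₁ hGR₂ hGR₃ η hη hηc h₁W A hV Φarch harm hdef χ ψ hψ ĉ hĉ hĉV χ'' hχ'')).symm

end Zero

/-! ## § 3. The big character of slot 0 -/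

/-- **the adelic `V`-character of slot 0**: `v ↦ η₀(v, 1) · χ₀(v, 1) = η(v, 1) · λ_V′(v)` on `U(diag frameD V)(𝔸)` — the `V`-parts of
the W pin's character and of the see-saw character of [Howe1979 §3] ∕ [GelbartRogawski1991 p. 457]. -/
def adelicCharZero : CMAdelic (L : Type) (frameD V) →* ℂˣ :=
  (eta₀ V c.D η).comp (MonoidHom.inl _ _) *
    (cmLineChar₀ (L : Type) finProdFinEquiv e₁ (frameD V) (frameD_real V) (frameD_ne V) (dW c.D) (dW_real c.D) (dW_ne c.D) hGR
        hGR₀ hGR₁).comp (MonoidHom.inl _ _)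

/-- (Ported verbatim from the HodgeCMPerL package; no docstring in the source.) -/
@[simp] theorem adelicCharZero_apply (v : CMAdelic (L : Type) (frameD V)) :
    adelicCharZero V c hGR hGR₀ hGR₁ η v =
      eta₀ V c.D η (v, 1) *
        cmLineChar₀ (L : Type) finProdFinEquiv e₁ (frameD V) (frameD_real V) (frameD_ne V) (dW c.D) (dW_real c.D) (dW_ne c.D) hGR
          hGR₀ hGR₁ (v, 1) := rfl

/-- the line `⟨a₀⟩` has a nonzero Gram entry. -/
theorem lineVec_dW_zero_ne : (Matrix.diagonal (lineVec (L : Type) (dW c.D 0))) default default ≠ 0 := by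
  rw [Fin.default_eq_zero, Matrix.diagonal_apply_eq]
  exact dW_ne c.D 0

/-- **THE BIG CHARACTER OF SLOT 0**: `ĉ₀ := adelicCharZero ∘ (G₁(𝔸) ≃ U(diag frameD V)(𝔸))` (#1255 `LinePair.bigCharOfV`). -/
def bigCharZero : (splitLineZero V c hGR₀).BigChar :=
  LinePair.bigCharOfV (↥(maximalRealSubfield L)) (L : Type) (IsCMField.complexConj L) 3 (Matrix.diagonal (frameD V))
    (Matrix.diagonal (lineVec (L : Type) (dW c.D 0))) (lineVec_dW_zero_ne c) (adelicCharZero V c hGR hGR₀ hGR₁ η)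

/-- **its `V`-part along `finFrameCongr` is `cVZero`** (the hypothesis `hĉV` of § 2, DISCHARGED for `ĉ₀`). -/
theorem twistCharV_bigCharZero_comp :
    (HodgeCM.WeilCoinv.twistCharV (↥(maximalRealSubfield L)) (L : Type) (IsCMField.complexConj L) 3 1
          (Matrix.diagonal (frameD V)) (splitLineZero V c hGR₀).JW (bigCharZero V c hGR hGR₀ hGR₁ η)).comp
        (finFrameCongr (L : Type) V.Hm (frameG V) (frameD V) (frame_congr V)) =
      cVZero V c hGR hGR₀ hGR₁ η := by
  ext g : 1
  rw [MonoidHom.comp_apply, cVZero_apply, finCharZero_apply, finPairD_apply, map_one, map_one]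
  show (HodgeCM.WeilCoinv.twistCharV (↥(maximalRealSubfield L)) (L : Type) (IsCMField.complexConj L) 3 1
      (Matrix.diagonal (frameD V)) (Matrix.diagonal (lineVec (L : Type) (dW c.D 0))) (bigCharZero V c hGR hGR₀ hGR₁ η)) _ = _
  rw [bigCharZero, LinePair.twistCharV_bigCharOfV, MonoidHom.comp_apply, adelicCharZero_apply]
  rfl

/-! ## § 4. Rational triviality of `ĉ₀` and the slot-0 arrow with no hypothesis left -/

include hGR hGR₀ hGR₁ in
/-- the see-saw character `λ_V′` of slot 0 is trivial on `U(diag frameD V)(L⁺)` ([Weil1964, Thm 6] through the tree's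
`charV₃₄_eq_one_of_rational` at `g₀ = 1`, `ratIsometry_one_lineVec`); hence `χ₀(γ, 1) = 1`. -/
theorem cmLineChar₀_inl_eq_one_of_rat {v : CMAdelic (L : Type) (frameD V)} (hv : v ∈ CMRat (L : Type) (frameD V)) :
    cmLineChar₀ (L : Type) finProdFinEquiv e₁ (frameD V) (frameD_real V) (frameD_ne V) (dW c.D) (dW_real c.D) (dW_ne c.D) hGR
        hGR₀ hGR₁ (v, 1) = 1 := by
  rw [cmLineChar₀]
  simp only [MonoidHom.mul_apply, MonoidHom.coe_comp, Function.comp_apply, MonoidHom.coe_fst, MonoidHom.coe_snd, map_one,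
    mul_one]
  apply charV₃₄_eq_one_of_rational
  · exact ratIsometry_one_lineVec (L : Type) (dW c.D)
  · exact hv

include hη in
/-- **`adelicCharZero = 1` on `U(diag frameD V)(L⁺)`**: the W pin's `hη` for `η(γ, 1)` and `cmLineChar₀_inl_eq_one_of_rat`. -/
theorem adelicCharZero_eq_one_of_rat {v : CMAdelic (L : Type) (frameD V)} (hv : v ∈ CMRat (L : Type) (frameD V)) :
    adelicCharZero V c hGR hGR₀ hGR₁ η v = 1 := by
  rw [adelicCharZero_apply, cmLineChar₀_inl_eq_one_of_rat V c hGR hGR₀ hGR₁ hv, mul_one]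
  have h := cmEta₀_eq_one_of_rat (L : Type) (frameD V) (dW c.D) η hη hv (one_mem _)
  rw [map_one] at h
  exact h

include hη in
/-- **`ĉ₀` IS RATIONALLY TRIVIAL** (axioms-1's `SplitLine.IsRatTrivial`, the automorphy input of `twistBy`): transfer along
`G₁(L⁺) ≃ U(diag frameD V)(L⁺)` (#1255 `bigCharOfV_rationalPairToAdelic'`). -/
theorem bigCharZero_isRatTrivial : (splitLineZero V c hGR₀).IsRatTrivial (bigCharZero V c hGR hGR₀ hGR₁ η) := fun γ₀ =>
  LinePair.bigCharOfV_rationalPairToAdelic' _ _ _ _ _ _ _ _ (fun _ hv => adelicCharZero_eq_one_of_rat V c hGR hGR₀ hGR₁ η hη hv) γ₀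

section ZeroFinal

variable (Φarch : Module.Dual ℂ (Fin 2 → ℂ) →ₗ[ℂ] 𝓢((Fin 3 → mixedSpace (↥(maximalRealSubfield L))), ℂ))
  (harm : ∀ (u : ↥(stabilizer U21 x₀)) (ℓ : Module.Dual ℂ (Fin 2 → ℂ)),
    lineOmega_zero V c.D hGR hGR₀ hGR₁ (eta₀ V c.D η) (u : U21) (Φarch ℓ) =
      Φarch ((BallForms.isPullbackCocycle_cotangentCocycle.weightOf x₀).dual u ℓ))
  (hdef : ∀ a : UnitaryGroup.arch (↥(maximalRealSubfield L)) L (IsCMField.complexConj L) 3 V.Hm,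
    UnitaryGroup.archAt (↥(maximalRealSubfield L)) L (IsCMField.complexConj L) 3 V.Hm (UnitaryGroup.cmPlace (L : Type) ι₁)
        (NumberField.complexConj_smul_infinitePlace (L : Type) _) (IsCMField.complexConj_ne_one (L : Type)) a = 1 →
    ∀ (ℓ : Module.Dual ℂ (Fin 2 → ℂ)) (Φf : FinSB (↥(maximalRealSubfield L)) (Fin 3)),
      lineRepOf V c.D hGR hGR₀ hGR₁ hGR₂ hGR₃ (eta₀ V c.D η) (eta₁ V c.D η) (eta₂ V c.D η) (eta₃ V c.D η) 0
          (HodgeCM.Adelic.regimeEquiv L V.Hm hV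
            (UnitaryGroup.archToAdelic (↥(maximalRealSubfield L)) L (IsCMField.complexConj L) 3 V.Hm a), 1)
          (piSchwartzBruhatEquiv (↥(maximalRealSubfield L)) (Fin 3) (Φarch ℓ ⊗ₜ[ℂ] Φf)) =
        piSchwartzBruhatEquiv (↥(maximalRealSubfield L)) (Fin 3) (Φarch ℓ ⊗ₜ[ℂ] Φf))
  (χ : PontryaginDual (↥(relNormOneIdeles (↥(maximalRealSubfield L)) L) ⧸ relNormOneRat (↥(maximalRealSubfield L)) L))
  (ψ : UfZero c.D →* ℂˣ)
  (hψ : ∀ u : UfZero c.D, chiZero c χ u = finCharZero V c.D hGR hGR₀ hGR₁ (eta₀ V c.D η) (1, u) * ψ u)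
  (χ'' : (splitLineZero V c hGR₀).CharW)
  (hχ'' : ∀ u, χ'' u =
    HodgeCM.WeilCoinv.twistCharW (↥(maximalRealSubfield L)) (L : Type) (IsCMField.complexConj L) 3 1
      (Matrix.diagonal (frameD V)) (splitLineZero V c hGR₀).JW (bigCharZero V c hGR hGR₀ hGR₁ η) u * ψ u)

include hη in
/-- **THE TWISTED INDEX RECORD OF SLOT 0**: `splitLineZero ⊗ ĉ₀`. -/
def splitLineZeroTwisted :
    SplitLine (Matrix.diagonal (frameD V)) (realDiagonal (L : Type) (frameD V) (frameD_real V))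
      (complexConj_imagUnit (L : Type)) (imagUnit_ne_zero (L : Type)) (imagUnit_mul_self (L : Type))
      (realDiagonal_isSymm (L : Type) (frameD V) (frameD_real V))
      (isUnit_det_realDiagonal (L : Type) (frameD V) (frameD_real V) (frameD_ne V))
      (realDiagonal_map (L : Type) (frameD V) (frameD_real V)).symm :=
  (splitLineZero V c hGR₀).twistBy (bigCharZero V c hGR hGR₀ hGR₁ η) (bigCharZero_isRatTrivial V c hGR hGR₀ hGR₁ η hη)

include hψ hχ'' in
/-- **SLOT 0 LANDS IN THE DICTIONARY, NO HYPOTHESIS ON THE RECORD LEFT**: `Ω(splitLineZero ⊗ ĉ₀, χ″) ≃ₗ[ℂ[U(V)(𝔸_f)]] Ω₀(χ)` for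
`χ″ = twistCharW ĉ₀ · ψ`, `chiZero χ = finCharZero(1, ·) · ψ`. -/
def dictEquivZero :
    (splitLineZeroTwisted V c hGR hGR₀ hGR₁ η hη).Ω (finFrameCongr (L : Type) V.Hm (frameG V) (frameD V) (frame_congr V)) χ''
      ≃ₗ[adelicAlgebra V]
      ((thetaDistDatumZeroOf V c hGR hGR₀ hGR₁ hGR₂ hGR₃ η hη hηc h₁W A hV Φarch harm hdef).coinvRep χ).asModule :=
  dictEquivZeroOfBigChar V c hGR hGR₀ hGR₁ hGR₂ hGR₃ η hη hηc h₁W A hV Φarch harm hdef χ ψ hψ _ _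
    (twistCharV_bigCharZero_comp V c hGR hGR₀ hGR₁ η) χ'' hχ''

include hψ hχ'' in
/-- **BLOCKS EQUAL (slot 0, at the twisted record)**. -/
theorem iSup_range_coinvRep_zero_eq_dictTwisted {T : Type*} [AddCommMonoid T] [Module ℂ T] [Module (adelicAlgebra V) T]
    [IsScalarTower ℂ (adelicAlgebra V) T] :
    (⨆ f : ((thetaDistDatumZeroOf V c hGR hGR₀ hGR₁ hGR₂ hGR₃ η hη hηc h₁W A hV Φarch harm hdef).coinvRep χ).asModule
        →ₗ[adelicAlgebra V] T, (LinearMap.range f).restrictScalars ℂ) =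
      ⨆ f : (splitLineZeroTwisted V c hGR hGR₀ hGR₁ η hη).Ω (finFrameCongr (L : Type) V.Hm (frameG V) (frameD V) (frame_congr V))
          χ'' →ₗ[adelicAlgebra V] T, (LinearMap.range f).restrictScalars ℂ :=
  (EquivariantLift.iSup_range_eq_of_equiv
    (dictEquivZero V c hGR hGR₀ hGR₁ hGR₂ hGR₃ η hη hηc h₁W A hV Φarch harm hdef χ ψ hψ χ'' hχ'')).symm

end ZeroFinal

/-! ### The canonical characters -/

section Canonical

variable (Φarch : Module.Dual ℂ (Fin 2 → ℂ) →ₗ[ℂ] 𝓢((Fin 3 → mixedSpace (↥(maximalRealSubfield L))), ℂ))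
  (harm : ∀ (u : ↥(stabilizer U21 x₀)) (ℓ : Module.Dual ℂ (Fin 2 → ℂ)),
    lineOmega_zero V c.D hGR hGR₀ hGR₁ (eta₀ V c.D η) (u : U21) (Φarch ℓ) =
      Φarch ((BallForms.isPullbackCocycle_cotangentCocycle.weightOf x₀).dual u ℓ))
  (hdef : ∀ a : UnitaryGroup.arch (↥(maximalRealSubfield L)) L (IsCMField.complexConj L) 3 V.Hm,
    UnitaryGroup.archAt (↥(maximalRealSubfield L)) L (IsCMField.complexConj L) 3 V.Hm (UnitaryGroup.cmPlace (L : Type) ι₁)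
        (NumberField.complexConj_smul_infinitePlace (L : Type) _) (IsCMField.complexConj_ne_one (L : Type)) a = 1 →
    ∀ (ℓ : Module.Dual ℂ (Fin 2 → ℂ)) (Φf : FinSB (↥(maximalRealSubfield L)) (Fin 3)),
      lineRepOf V c.D hGR hGR₀ hGR₁ hGR₂ hGR₃ (eta₀ V c.D η) (eta₁ V c.D η) (eta₂ V c.D η) (eta₃ V c.D η) 0
          (HodgeCM.Adelic.regimeEquiv L V.Hm hV
            (UnitaryGroup.archToAdelic (↥(maximalRealSubfield L)) L (IsCMField.complexConj L) 3 V.Hm a), 1)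
          (piSchwartzBruhatEquiv (↥(maximalRealSubfield L)) (Fin 3) (Φarch ℓ ⊗ₜ[ℂ] Φf)) =
        piSchwartzBruhatEquiv (↥(maximalRealSubfield L)) (Fin 3) (Φarch ℓ ⊗ₜ[ℂ] Φf))
  (χ : PontryaginDual (↥(relNormOneIdeles (↥(maximalRealSubfield L)) L) ⧸ relNormOneRat (↥(maximalRealSubfield L)) L))

/-- **the canonical dictionary character of slot 0 at `χ`**: `χ″₀(χ) := twistCharW ĉ₀ · ψ₀(χ)` (`ψ₀ = psiZero`, #1254). -/
def charZeroDict : (splitLineZero V c hGR₀).CharW :=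
  HodgeCM.WeilCoinv.twistCharW (↥(maximalRealSubfield L)) (L : Type) (IsCMField.complexConj L) 3 1
      (Matrix.diagonal (frameD V)) (splitLineZero V c hGR₀).JW (bigCharZero V c hGR hGR₀ hGR₁ η) *
    (show (splitLineZero V c hGR₀).CharW from psiZero V c hGR hGR₀ hGR₁ η χ)

/-- **SLOT 0, CANONICAL FORM**: `Ω(splitLineZero ⊗ ĉ₀, χ″₀(χ)) ≃ₗ[ℂ[U(V)(𝔸_f)]] Ω₀(χ)` — the index pair `(splitLineZeroTwisted, charZeroDict χ)`
of axioms-1's dictionary at binder-2's `ιVE V = finFrameCongr` carries EXACTLY the honest slot-0 module of #1248/#1250 (for every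
`(Φarch, harm, hdef)`, hence for binder-1's `pinDatumZero`). -/
def dictEquivZeroCanonical :
    (splitLineZeroTwisted V c hGR hGR₀ hGR₁ η hη).Ω (finFrameCongr (L : Type) V.Hm (frameG V) (frameD V) (frame_congr V))
        (charZeroDict V c hGR hGR₀ hGR₁ η χ) ≃ₗ[adelicAlgebra V]
      ((thetaDistDatumZeroOf V c hGR hGR₀ hGR₁ hGR₂ hGR₃ η hη hηc h₁W A hV Φarch harm hdef).coinvRep χ).asModule :=
  dictEquivZero V c hGR hGR₀ hGR₁ hGR₂ hGR₃ η hη hηc h₁W A hV Φarch harm hdef χ (psiZero V c hGR hGR₀ hGR₁ η χ)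
    (chiZero_eq_mul_psiZero V c hGR hGR₀ hGR₁ η χ) (charZeroDict V c hGR hGR₀ hGR₁ η χ) fun _ => rfl

/-- hence the `adelicAlgebra V`-linear SURJECTION the pinned junction's block socket (#101 ∕ #102
`mem_biSup_block_pin_of_mem_iSup_range`) consumes, slot 0. -/
theorem dictEquivZeroCanonical_surjective :
    Function.Surjective (dictEquivZeroCanonical V c hGR hGR₀ hGR₁ hGR₂ hGR₃ η hη hηc h₁W A hV Φarch harm hdef χ) :=
  (dictEquivZeroCanonical V c hGR hGR₀ hGR₁ hGR₂ hGR₃ η hη hηc h₁W A hV Φarch harm hdef χ).surjective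

end Canonical

end ThetaAdelicSide
end HodgeCM.Model

end
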